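import Summits.CriticalPhenomena.PercolationContinuityZ3.Theorems.PercNearOneGluingNoHeavyQuantIndepBlobTruncatedMeanIneq
import Summits.CriticalPhenomena.PercolationContinuityZ3.Theorems.PercNearOneGluingNoHeavyQuantIndepBlobGapCalculus
import HarnessLib

/-!
# QUANT lane R8, Conjecture DIB\* — the TRUNCATED-MEAN THEOREM for light clouds, part II: the induction on the cloud
# (`E[min(Λ, t)] ≥ min(C, x·t)` for every `t ≥ max b`, any number of lights)

builds on p205010 (kernel theorem, internal audit signed; external expert review pending)

Support file (`--supports stmt-CriticalPhenomena-4575`), QUANT lane census seat prim-quant-census-1 (gen 16), rung R8 of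
`run/shared/lean/prim/quant/LADDER.md`; memo `run/shared/lean/prim/quant/prim-quant-census-1/TRUNCATED-MEAN-G16.md`.  Part (VIII) of the cloud
series; the four real inequalities are part (VII) `…TruncatedMeanIneq`.  Theorems only, no definitions, no sorries, standard axioms; restricted
product weights `w_L(S) = Π_{k ∈ L} (p k | 1 − p k)` as in `…QuantIndepBlobGapCalculus` (`sum_powerset_weight_insert`, `sum_powerset_weight`).

SETTING.  A finset `L` of blobs (the LIGHT CLOUD) with real sizes `b k ≥ 0` and gates `p k ∈ [x², x)`, floor `1/2 ≤ x < 1`; the TRUNCATED MEAN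
`T_L(t) := Σ_{S ⊆ L} w_L(S)·min(b(S), t) = E[min(Λ, t)]` and the discounted credit `C_L = Σ_{k ∈ L} b k·(p k − x²)/(1 − x)`.

* `Quant.IndepBlob.truncMean_insert` — conditioning on one light; `truncMean_open_peel` (`min(c + s, t) = c + min(s, t − c)`),
  `truncMean_open_top` (if every light of `L` exceeds `t − c` then `Σ_S w_L(S) min(c + b(S), t) = t − (t − c)·Π_L(1 − p)`),
  `sum_powerset_singleton_weight`, `truncMean_singleton`, `prod_one_sub_le_pow_card`.
* **`Quant.IndepBlob.truncMean_ge_min` — THE TRUNCATED-MEAN THEOREM: `1/2 ≤ x < 1`, gates in `[x², x)`, sizes `0 ≤ b k ≤ t` ⟹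
  `min(C_L, x t) ≤ T_L(t)`, and `x t < T_L(t)` whenever `x t < C_L`.**  Proof = the induction of part VII's docstring: peel the smallest light
  when `b_min + b_max ≤ t` (`tm_peel`), otherwise condition on the largest (`truncMean_open_top` makes its open branch exact) and close with
  `tm_top` when `Π_{L'}(1 − p) ≤ 1 − x` — automatic once `|L'| ≥ 3` by `one_sub_sq_pow_three_le` —, else with the explicit `tm_two` /
  `tm_three`.
In particular (t = C_L/x ≥ max b) the OVERSHOOT LEMMA (OS) `E[(Λ − C_L/x)₊] ≤ x²(Σ b − C_L/x)` and (t = max b) the lower endpoint (LE) of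
SMALL-CLOUD-G15 §11 hold for every light cloud; part (IX) `…AllMedium` turns the strict form into Conjecture DIB\* for all-medium clouds.

NOVELTY: as in part VII (presearch recorded there). [this work; this lane's census]; the gluing rows served:
[cite: KozmaNitzan2024, Conjecture 3 (p. 15)]; product weights [cite: Grimmett1999, §1.3 p. 10].
-/

namespace Summit.CriticalPhenomena.PercolationContinuityZ3.Theorems

namespace Quant

namespace IndepBlob

open Finset

variable {κ : Type*} [DecidableEq κ]

/-- restricted product weight of the outcome `S` of the cloud `L` -/
local notation3 "wL[" p ", " L ", " S "]" =>
  ∏ k ∈ (L : Finset κ), (if k ∈ (S : Finset κ) then (p : κ → ℝ) k else 1 - (p : κ → ℝ) k)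

/-- the truncated mean `T_L(t) = E[min(Λ_L, t)]` -/
local notation3 "TM[" p ", " b ", " L ", " t "]" =>
  ∑ S ∈ (L : Finset κ).powerset, wL[p, L, S] * min (∑ k ∈ S, (b : κ → ℝ) k) (t : ℝ)

/-! ### 16. Conditioning a truncated mean on one light -/

/-- **Conditioning on one light** `k ∉ L`:
`T_{L+k}(t) = p k·Σ_{S ⊆ L} w_L(S) min(b k + b(S), t) + (1 − p k)·T_L(t)`. [folklore] -/
theorem truncMean_insert (p b : κ → ℝ) (L : Finset κ) (k : κ) (hk : k ∉ L) (t : ℝ) :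
    TM[p, b, insert k L, t] =
      p k * ∑ S ∈ L.powerset, wL[p, L, S] * min (b k + ∑ i ∈ S, b i) t + (1 - p k) * TM[p, b, L, t] := by
  rw [sum_powerset_weight_insert p L k hk (fun S => min (∑ i ∈ S, b i) t)]
  congr 1
  congr 1
  refine Finset.sum_congr rfl fun S hS => ?_
  have hkS : k ∉ S := fun h => hk (Finset.mem_powerset.1 hS h)
  rw [Finset.sum_insert hkS]

/-- **The open branch after peeling**: `Σ_S w_L(S) min(c + b(S), t) = c + T_L(t − c)`. [folklore] -/
theorem truncMean_open_peel (p b : κ → ℝ) (L : Finset κ) (c t : ℝ) :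
    ∑ S ∈ L.powerset, wL[p, L, S] * min (c + ∑ i ∈ S, b i) t = c + TM[p, b, L, t - c] := by
  have e : ∀ S : Finset κ, min (c + ∑ i ∈ S, b i) t = c + min (∑ i ∈ S, b i) (t - c) := by
    intro S
    rw [← min_add_add_left c (∑ i ∈ S, b i) (t - c), add_sub_cancel]
  simp_rw [e, mul_add, Finset.sum_add_distrib, ← Finset.sum_mul, sum_powerset_weight, one_mul]

/-- The weight of the empty outcome is `Π_L (1 − p)`. [folklore] -/
theorem weight_empty (p : κ → ℝ) (L : Finset κ) : wL[p, L, (∅ : Finset κ)] = ∏ k ∈ L, (1 - p k) :=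
  Finset.prod_congr rfl fun k _ => by rw [if_neg (Finset.notMem_empty k)]

/-- **The open branch of the largest light is exact**: if `c ≤ t` and every light of `L` (sizes `≥ 0`) exceeds `t − c`, then any
non-empty outcome completes the target: `Σ_S w_L(S) min(c + b(S), t) = t − (t − c)·Π_L(1 − p)`. [this work] -/
theorem truncMean_open_top (p b : κ → ℝ) (L : Finset κ) (c t : ℝ) (hct : c ≤ t) (hb0 : ∀ i ∈ L, 0 ≤ b i)
    (hbig : ∀ i ∈ L, t - c < b i) :
    ∑ S ∈ L.powerset, wL[p, L, S] * min (c + ∑ i ∈ S, b i) t = t - (t - c) * ∏ k ∈ L, (1 - p k) := by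
  have e : ∀ S ∈ L.powerset, wL[p, L, S] * min (c + ∑ i ∈ S, b i) t =
      wL[p, L, S] * t - (if S = ∅ then wL[p, L, S] * (t - c) else 0) := by
    intro S hS
    have hSL : S ⊆ L := Finset.mem_powerset.1 hS
    by_cases hS0 : S = ∅
    · subst hS0
      rw [if_pos rfl, Finset.sum_empty, add_zero, min_eq_left hct]; ring
    · rw [if_neg hS0, sub_zero]
      obtain ⟨i, hi⟩ := Finset.nonempty_iff_ne_empty.2 hS0
      have h1 : b i ≤ ∑ i ∈ S, b i := Finset.single_le_sum (fun j hj => hb0 j (hSL hj)) hi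
      have h2 : t ≤ c + ∑ i ∈ S, b i := by linarith [hbig i (hSL hi)]
      rw [min_eq_right h2]
  rw [Finset.sum_congr rfl e, Finset.sum_sub_distrib, ← Finset.sum_mul, sum_powerset_weight, one_mul,
    Finset.sum_ite_eq' L.powerset (∅ : Finset κ) (fun S => wL[p, L, S] * (t - c)), if_pos (Finset.empty_mem_powerset L),
    weight_empty]
  ring

/-- Integrating against the weights of a ONE-light cloud: `Σ_{S ⊆ {i}} w_{{i}}(S) F(S) = (1 − p i)·F ∅ + p i·F {i}`. [folklore] -/
theorem sum_powerset_singleton_weight (p : κ → ℝ) (i : κ) (F : Finset κ → ℝ) :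
    ∑ S ∈ ({i} : Finset κ).powerset, wL[p, {i}, S] * F S = (1 - p i) * F ∅ + p i * F {i} := by
  have h := sum_powerset_weight_insert p (∅ : Finset κ) i (Finset.notMem_empty i) F
  simp only [Finset.powerset_empty, Finset.sum_singleton, Finset.prod_empty, one_mul, insert_empty_eq] at h
  rw [h]; ring

/-- The truncated mean of ONE light: `T_{{i}}(t) = p i·min(b i, t)` (`t ≥ 0`). [folklore] -/
theorem truncMean_singleton (p b : κ → ℝ) (i : κ) (t : ℝ) (ht : 0 ≤ t) : TM[p, b, {i}, t] = p i * min (b i) t := by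
  rw [sum_powerset_singleton_weight p i (fun S => min (∑ k ∈ S, b k) t)]
  simp only [Finset.sum_empty, Finset.sum_singleton, min_eq_left ht, mul_zero, zero_add]

omit [DecidableEq κ] in
/-- Unreliable lights: `Π_L (1 − p) ≤ (1 − x²)^{|L|}` when every gate of `L` lies in `[x², 1]`. [folklore] -/
theorem prod_one_sub_le_pow_card (p : κ → ℝ) (L : Finset κ) (x : ℝ) (hlo : ∀ k ∈ L, x ^ 2 ≤ p k) (hhi : ∀ k ∈ L, p k ≤ 1) :
    ∏ k ∈ L, (1 - p k) ≤ (1 - x ^ 2) ^ L.card := by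
  rw [← Finset.prod_const]
  exact Finset.prod_le_prod (fun k hk => by linarith [hhi k hk]) (fun k hk => by linarith [hlo k hk])

/-! ### 17. The truncated-mean theorem -/

/-- the discounted credit clears its denominator -/
private theorem credit_mul (x g b : ℝ) (hx1 : x < 1) : (b * ((g - x ^ 2) / (1 - x))) * (1 - x) = b * (g - x ^ 2) := by
  have h : (1 - x) ≠ 0 := by intro h; linarith
  rw [mul_assoc, div_mul_cancel₀ _ h]

/-- **THE TRUNCATED-MEAN THEOREM** (any number of lights), by strong induction on the number of lights — see the module docstring.
Floor `1/2 ≤ x < 1`, a finset `L` with gates `p k ∈ [x², x)` and sizes `0 ≤ b k ≤ t` (`t ≥ 0`):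
`min(Σ_L b·κ_x(p), x·t) ≤ T_L(t)`, and `x·t < T_L(t)` as soon as `x·t < Σ_L b·κ_x(p)`. [this work] -/
theorem truncMean_ge_min (x : ℝ) (hx : 1 / 2 ≤ x) (hx1 : x < 1) (p b : κ → ℝ) :
    ∀ (n : ℕ) (L : Finset κ), L.card = n → ∀ t : ℝ, 0 ≤ t →
      (∀ k ∈ L, 0 ≤ p k ∧ p k < x) → (∀ k ∈ L, 0 ≤ b k) → (∀ k ∈ L, b k ≤ t) →
      min (∑ k ∈ L, b k * ((p k - x ^ 2) / (1 - x))) (x * t) ≤ TM[p, b, L, t] ∧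
        (x * t < ∑ k ∈ L, b k * ((p k - x ^ 2) / (1 - x)) → x * t < TM[p, b, L, t]) := by
  have hx0 : 0 < x := by linarith
  have h1x : 0 < 1 - x := by linarith
  intro n
  induction n using Nat.strong_induction_on with
  | _ n ih =>
  intro L hcard t ht0 hgate hb0 hbt
  -- gates are in `[0, 1]`
  have hp0 : ∀ k ∈ L, 0 ≤ p k := fun k hk => (hgate k hk).1
  have hp1 : ∀ k ∈ L, p k ≤ 1 := fun k hk => ((hgate k hk).2.le.trans hx1.le)
  rcases L.eq_empty_or_nonempty with hL0 | hne
  · -- no light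
    subst hL0
    simp only [Finset.sum_empty, Finset.powerset_empty, Finset.sum_singleton, Finset.prod_empty, one_mul, min_eq_left ht0]
    exact ⟨min_le_left _ _, fun h => absurd h (not_lt.2 (by positivity))⟩
  have hn1 : 1 ≤ n := by rw [← hcard]; exact Finset.card_pos.2 hne
  -- a light below `x²` has negative credit and is peeled off by monotonicity
  by_cases hjunk : ∃ k ∈ L, p k < x ^ 2
  · obtain ⟨k, hkL, hk⟩ := hjunk
    set L' : Finset κ := L.erase k with hL'def
    have hL' : L = insert k L' := (Finset.insert_erase hkL).symm
    have hkL' : k ∉ L' := Finset.notMem_erase k L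
    have hsub' : ∀ i ∈ L', i ∈ L := fun i hi => Finset.mem_of_mem_erase hi
    have hcard' : L'.card = n - 1 := by rw [hL'def, Finset.card_erase_of_mem hkL, hcard]
    have IH₀ := ih (n - 1) (by omega) L' hcard' t ht0 (fun i hi => hgate i (hsub' i hi))
      (fun i hi => hb0 i (hsub' i hi)) (fun i hi => hbt i (hsub' i hi))
    -- `T_L(t) ≥ T_{L'}(t)`
    have hmono : TM[p, b, L', t] ≤ ∑ S ∈ L'.powerset, wL[p, L', S] * min (b k + ∑ i ∈ S, b i) t :=
      Finset.sum_le_sum fun S _ => mul_le_mul_of_nonneg_left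
        (min_le_min_right t (le_add_of_nonneg_left (hb0 k hkL)))
        (weightU_nonneg p L' (fun i hi => hp0 i (hsub' i hi)) (fun i hi => hp1 i (hsub' i hi)) S)
    have hTM : TM[p, b, L', t] ≤ TM[p, b, L, t] := by
      rw [hL', truncMean_insert p b L' k hkL' t]
      nlinarith [hp0 k hkL, hp1 k hkL]
    -- the credit only grows without the junk light
    have hKk : b k * ((p k - x ^ 2) / (1 - x)) ≤ 0 :=
      mul_nonpos_of_nonneg_of_nonpos (hb0 k hkL) (div_nonpos_of_nonpos_of_nonneg (by linarith) h1x.le)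
    have hC : ∑ i ∈ L, b i * ((p i - x ^ 2) / (1 - x)) ≤ ∑ i ∈ L', b i * ((p i - x ^ 2) / (1 - x)) := by
      rw [hL', Finset.sum_insert hkL']; linarith
    refine ⟨?_, fun h => (IH₀.2 (h.trans_le hC)).trans_le hTM⟩
    exact ((min_le_min_right (x * t) hC).trans IH₀.1).trans hTM
  push Not at hjunk
  -- the smallest light `ℓ₁`
  obtain ⟨ℓ₁, hℓ₁L, hmin⟩ := Finset.exists_min_image L b hne
  set L₁ : Finset κ := L.erase ℓ₁ with hL₁
  have hL : L = insert ℓ₁ L₁ := (Finset.insert_erase hℓ₁L).symm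
  have hℓ₁L₁ : ℓ₁ ∉ L₁ := Finset.notMem_erase ℓ₁ L
  have hcard₁ : L₁.card = n - 1 := by rw [hL₁, Finset.card_erase_of_mem hℓ₁L, hcard]
  have hK₁ := credit_mul x (p ℓ₁) (b ℓ₁) hx1
  have hg₁ := hgate ℓ₁ hℓ₁L
  have hCsplit : ∑ k ∈ L, b k * ((p k - x ^ 2) / (1 - x)) =
      b ℓ₁ * ((p ℓ₁ - x ^ 2) / (1 - x)) + ∑ k ∈ L₁, b k * ((p k - x ^ 2) / (1 - x)) := by
    rw [hL, Finset.sum_insert hℓ₁L₁]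
  rcases L₁.eq_empty_or_nonempty with hL₁0 | hne₁
  · -- ONE light: `T = p·b ≥ κ·b`
    have hLeq : L = {ℓ₁} := by rw [hL, hL₁0, insert_empty_eq]
    rw [hLeq, Finset.sum_singleton, truncMean_singleton p b ℓ₁ t ht0, min_eq_left (hbt ℓ₁ hℓ₁L)]
    have hle : b ℓ₁ * ((p ℓ₁ - x ^ 2) / (1 - x)) ≤ p ℓ₁ * b ℓ₁ :=
      discount_le_mean x (p ℓ₁) (b ℓ₁) _ hx0.le hx1 hg₁.2.le (hb0 ℓ₁ hℓ₁L) hK₁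
    exact ⟨(min_le_left _ _).trans hle, fun h => h.trans_le hle⟩
  -- the largest light `N ≠ ℓ₁`
  obtain ⟨N, hNL₁, hmax⟩ := Finset.exists_max_image L₁ b hne₁
  have hNL : N ∈ L := Finset.mem_of_mem_erase hNL₁
  have hNℓ₁ : N ≠ ℓ₁ := Finset.ne_of_mem_erase hNL₁
  have hmaxL : ∀ k ∈ L, b k ≤ b N := by
    intro k hk
    by_cases hk1 : k = ℓ₁
    · rw [hk1]; exact hmin N hNL
    · exact hmax k (Finset.mem_erase.2 ⟨hk1, hk⟩)
  have hKN := credit_mul x (p N) (b N) hx1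
  have hgN := hgate N hNL
  have hgN0 : 0 < p N := lt_of_lt_of_le (by positivity) (hjunk N hNL)
  by_cases hP : b ℓ₁ + b N ≤ t
  · -- (P) peel the smallest light
    have hbℓ₁t : b ℓ₁ ≤ t := by linarith [hb0 N hNL]
    have IH₁ := ih (n - 1) (by omega) L₁ hcard₁ (t - b ℓ₁) (by linarith)
      (fun k hk => hgate k (Finset.mem_of_mem_erase hk)) (fun k hk => hb0 k (Finset.mem_of_mem_erase hk))
      (fun k hk => by linarith [hmax k hk])
    have IH₀ := ih (n - 1) (by omega) L₁ hcard₁ t ht0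
      (fun k hk => hgate k (Finset.mem_of_mem_erase hk)) (fun k hk => hb0 k (Finset.mem_of_mem_erase hk))
      (fun k hk => hbt k (Finset.mem_of_mem_erase hk))
    have hTM : TM[p, b, L, t] = p ℓ₁ * (b ℓ₁ + TM[p, b, L₁, t - b ℓ₁]) + (1 - p ℓ₁) * TM[p, b, L₁, t] := by
      rw [hL, truncMean_insert p b L₁ ℓ₁ hℓ₁L₁ t, truncMean_open_peel]
    rw [hTM, hCsplit, add_comm (b ℓ₁ * _)]
    exact tm_peel x (p ℓ₁) (b ℓ₁) _ _ t _ _ hx0 hx1 (hp0 ℓ₁ hℓ₁L) hg₁.2.le (hb0 ℓ₁ hℓ₁L) hK₁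
      IH₁.1 IH₁.2 IH₀.1 IH₀.2
  -- (NP) condition on the largest light
  push Not at hP
  set L' : Finset κ := L.erase N with hL'def
  have hL' : L = insert N L' := (Finset.insert_erase hNL).symm
  have hNL' : N ∉ L' := Finset.notMem_erase N L
  have hℓ₁L' : ℓ₁ ∈ L' := Finset.mem_erase.2 ⟨hNℓ₁.symm, hℓ₁L⟩
  have hcard' : L'.card = n - 1 := by rw [hL'def, Finset.card_erase_of_mem hNL, hcard]
  have hsub' : ∀ k ∈ L', k ∈ L := fun k hk => Finset.mem_of_mem_erase hk
  have hbig : ∀ i ∈ L', t - b N < b i := fun i hi => by linarith [hmin i (hsub' i hi)]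
  have hbNt : b N ≤ t := hbt N hNL
  have hbNpos : 0 < b N := by linarith [hmin N hNL]
  have hCsplit' : ∑ k ∈ L, b k * ((p k - x ^ 2) / (1 - x)) =
      b N * ((p N - x ^ 2) / (1 - x)) + ∑ k ∈ L', b k * ((p k - x ^ 2) / (1 - x)) := by
    rw [hL', Finset.sum_insert hNL']
  have hTM : TM[p, b, L, t] = p N * (t - (t - b N) * ∏ k ∈ L', (1 - p k)) + (1 - p N) * TM[p, b, L', t] := by
    rw [hL', truncMean_insert p b L' N hNL' t,
      truncMean_open_top p b L' (b N) t hbNt (fun i hi => hb0 i (hsub' i hi)) hbig]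
  have IH₀ := ih (n - 1) (by omega) L' hcard' t ht0 (fun k hk => hgate k (hsub' k hk))
    (fun k hk => hb0 k (hsub' k hk)) (fun k hk => hbt k (hsub' k hk))
  have hQ0 : 0 ≤ ∏ k ∈ L', (1 - p k) := Finset.prod_nonneg fun k hk => by linarith [hp1 k (hsub' k hk)]
  by_cases hQ : ∏ k ∈ L', (1 - p k) ≤ 1 - x
  · -- inductive closed branch
    rw [hTM, hCsplit', add_comm (b N * _)]
    exact tm_top x (p N) (b N) _ _ t _ _ hx1 hgN0 hgN.2.le hbNpos
      (mul_le_mul_of_nonneg_left hQ (by linarith)) hKN IH₀.1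
  -- the residual shapes: `Π_{L'}(1 − p) > 1 − x` forces `|L'| ≤ 2`
  push Not at hQ
  have hcard2 : L'.card ≤ 2 := by
    by_contra h
    push Not at h
    have h1 : ∏ k ∈ L', (1 - p k) ≤ (1 - x ^ 2) ^ L'.card :=
      prod_one_sub_le_pow_card p L' x (fun k hk => hjunk k (hsub' k hk)) (fun k hk => hp1 k (hsub' k hk))
    have hsq0 : 0 ≤ 1 - x ^ 2 := by nlinarith
    have hsq1 : 1 - x ^ 2 ≤ 1 := by nlinarith
    have h2 : (1 - x ^ 2) ^ L'.card ≤ (1 - x ^ 2) ^ 3 := pow_le_pow_of_le_one hsq0 hsq1 (by omega)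
    have h3 := one_sub_sq_pow_three_le x hx hx1.le
    linarith
  -- `L' = insert ℓ₁ L''`
  set L'' : Finset κ := L'.erase ℓ₁ with hL''def
  have hL'2 : L' = insert ℓ₁ L'' := (Finset.insert_erase hℓ₁L').symm
  have hℓ₁L'' : ℓ₁ ∉ L'' := Finset.notMem_erase ℓ₁ L'
  have hcard'' : L''.card = L'.card - 1 := by rw [hL''def, Finset.card_erase_of_mem hℓ₁L']
  have hcardpos : 1 ≤ L'.card := Finset.card_pos.2 ⟨ℓ₁, hℓ₁L'⟩
  rcases Nat.lt_or_ge L'.card 2 with hc1 | hc2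
  · -- TWO lights: `L' = {ℓ₁}`
    have hL''0 : L'' = ∅ := Finset.card_eq_zero.1 (by omega)
    have hL'eq : L' = {ℓ₁} := by rw [hL'2, hL''0, insert_empty_eq]
    rw [hTM, hCsplit', hL'eq, Finset.sum_singleton, Finset.prod_singleton, truncMean_singleton p b ℓ₁ t ht0,
      min_eq_left (hbt ℓ₁ hℓ₁L), add_comm (b N * _)]
    exact tm_two x (p ℓ₁) (p N) (b ℓ₁) (b N) _ _ t hx0 hx1 hg₁.2.le hgN0.le hgN.2.le hK₁ hKN hP.le
  · -- THREE lights: `L' = {ℓ₁, ℓ₂}` with `b ℓ₁ ≤ b ℓ₂ ≤ b N`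
    have hc'' : L''.card = 1 := by omega
    obtain ⟨ℓ₂, hL''eq⟩ := Finset.card_eq_one.1 hc''
    have hℓ₂L'' : ℓ₂ ∈ L'' := by rw [hL''eq]; exact Finset.mem_singleton_self ℓ₂
    have hℓ₂L' : ℓ₂ ∈ L' := Finset.mem_of_mem_erase hℓ₂L''
    have hℓ₂L : ℓ₂ ∈ L := hsub' ℓ₂ hℓ₂L'
    have hℓ₁₂ : ℓ₁ ≠ ℓ₂ := fun h => hℓ₁L'' (h ▸ hℓ₂L'')
    have hℓ₁s : ℓ₁ ∉ ({ℓ₂} : Finset κ) := fun h => hℓ₁₂ (Finset.mem_singleton.1 h)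
    have hL'eq : L' = insert ℓ₁ {ℓ₂} := by rw [hL'2, hL''eq]
    have hg₂ := hgate ℓ₂ hℓ₂L
    have hK₂ := credit_mul x (p ℓ₂) (b ℓ₂) hx1
    -- the closed branch, explicitly
    have hT₀ : TM[p, b, L', t] = p ℓ₁ * ((1 - p ℓ₂) * b ℓ₁ + p ℓ₂ * min (b ℓ₁ + b ℓ₂) t) + (1 - p ℓ₁) * (p ℓ₂ * b ℓ₂) := by
      rw [hL'eq, truncMean_insert p b {ℓ₂} ℓ₁ hℓ₁s t, truncMean_singleton p b ℓ₂ t ht0, min_eq_left (hbt ℓ₂ hℓ₂L),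
        sum_powerset_singleton_weight p ℓ₂ (fun S => min (b ℓ₁ + ∑ i ∈ S, b i) t)]
      simp only [Finset.sum_empty, Finset.sum_singleton, add_zero, min_eq_left (hbt ℓ₁ hℓ₁L)]
    have hQ' : ∏ k ∈ L', (1 - p k) = (1 - p ℓ₁) * (1 - p ℓ₂) := by
      rw [hL'eq, Finset.prod_insert hℓ₁s, Finset.prod_singleton]
    have hC' : ∑ k ∈ L', b k * ((p k - x ^ 2) / (1 - x)) =
        b ℓ₁ * ((p ℓ₁ - x ^ 2) / (1 - x)) + b ℓ₂ * ((p ℓ₂ - x ^ 2) / (1 - x)) := by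
      rw [hL'eq, Finset.sum_insert hℓ₁s, Finset.sum_singleton]
    have key := tm_three x (p ℓ₁) (p ℓ₂) (p N) (b ℓ₁) (b ℓ₂) (b N) _ _ _ t hx0 hx1 (hp0 ℓ₁ hℓ₁L) hg₁.2.le
      (hp0 ℓ₂ hℓ₂L) hg₂.2.le hgN0.le hgN.2.le hK₁ hK₂ hKN (hb0 ℓ₁ hℓ₁L) (hmin ℓ₂ hℓ₂L) (hbt ℓ₂ hℓ₂L)
      (by linarith [hmin ℓ₂ hℓ₂L]) (by rw [← hQ']; exact hQ.le)
    have hE : p N * (t - (t - b N) * ∏ k ∈ L', (1 - p k)) + (1 - p N) * TM[p, b, L', t] =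
        p N * (t - (t - b N) * ((1 - p ℓ₁) * (1 - p ℓ₂))) + (1 - p N) *
          (p ℓ₁ * (1 - p ℓ₂) * b ℓ₁ + (1 - p ℓ₁) * p ℓ₂ * b ℓ₂ + p ℓ₁ * p ℓ₂ * min (b ℓ₁ + b ℓ₂) t) := by
      rw [hQ', hT₀]; ring
    have hCe : ∑ k ∈ L, b k * ((p k - x ^ 2) / (1 - x)) =
        b ℓ₁ * ((p ℓ₁ - x ^ 2) / (1 - x)) + b ℓ₂ * ((p ℓ₂ - x ^ 2) / (1 - x)) + b N * ((p N - x ^ 2) / (1 - x)) := by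
      rw [hCsplit', hC']; ring
    rw [hTM, hE, hCe]
    exact key

end IndepBlob

end Quant

end Summit.CriticalPhenomena.PercolationContinuityZ3.Theorems
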